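import Summits.ResolutionOfSingularities.ResolutionOfSingularities.Theorems.FrobeniusClosingPatchingRelPerfectDepthGradedTargets
import Summits.ResolutionOfSingularities.ResolutionOfSingularities.Theorems.FrobeniusClosingPatchingRelPerfectDepthSingleFormBasics
import HarnessLib

/-!
# Crux `PatchingRelPerfect` (stmt-ResolutionOfSingularities-16161), chain W5.2 — TargetsF4 support target
# `DepthTargets.SingleFormBasics` CLOSED BY NAME

[OURS · L1 W5.2 · TargetsF4 (B)] plan-1 g7 STEER 06:34:44Z (B) (res-type-003). The typed target `SingleFormBasics`
(`…DepthGradedTargets`, p507151 = plan-1's F4 1368f4d475f6043c: the form ideal sheaf of ONE non-zero form of degree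
`d ≥ 1` on `ℙ^m_{κ₀}` is locally principal) from the content theorem
`DepthTargets.projIdealSheaf_single_ne_bot_and_isLocallyPrincipal` (`…DepthSingleFormBasics`, p506283), which proves
non-vanishing as well and needs no `1 ≤ d`. Fact-free; nothing here is a statement of the manuscript under review.

## References
* R. Hartshorne, *Algebraic Geometry* (1977), II Prop. 5.11 (b). [Hartshorne1977]
-/

-- `Summit.<Summit>.<Sub>.Theorems` with `Sub = Summit` (single-conjunct summit, D-0017)
set_option linter.dupNamespace false

noncomputable section

open CategoryTheory AlgebraicGeometry
open Literature.AlgebraicGeometry.Resolution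

namespace Summit.ResolutionOfSingularities.ResolutionOfSingularities.Theorems.DepthTargets

universe u

/-- **TargetsF4 (B) by name**: the form ideal sheaf of one non-zero form on `ℙ^m_{κ₀}` is locally principal.
[cite: Hartshorne1977, II Prop. 5.11 (b)] -/
theorem singleFormBasics_holds : SingleFormBasics.{u} := by
  intro κ₀ _ m d _ P hP hP0
  exact (projIdealSheaf_single_ne_bot_and_isLocallyPrincipal κ₀ m d P hP hP0).2

end Summit.ResolutionOfSingularities.ResolutionOfSingularities.Theorems.DepthTargets

end
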